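import Summits.BirchSwinnertonDyer.BirchSwinnertonDyer.Theorems.ClassRecordThreeCornerAtThreeAdmissibleOfAtMostTwoSplit
import Summits.BirchSwinnertonDyer.Rank1Residual.X11b.Three.TamagawaAtomClass
import HarnessLib

/-!
# Crux `CornerAtThreeW` (item stmt-BirchSwinnertonDyer-21420; 19111 aside), conjunct (U): admissibility UP TO ONE exempted place is AUTOMATIC
# at a corner curve with EXACTLY ONE (T2γ) place, at most ONE split multiplicative prime `≠ 3`, and a second multiplicative prime —
# the (T2γ) complement of `…AdmissibleOfAtMostTwoSplit` (cell `bsd-stepL`, seat `bsd-stepL-corner-p1` g13; `--supports 21420 --as helper`)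

WHY THIS FILE. `…CornerAtThreeAdmissibleOfAtMostTwoSplit` (p588463) settles lane B's admissibility predicates class-wide OFF (T2γ). ON (T2γ) with a
UNIQUE place `v₁` of type IV ∕ IV* with `c_{v₁} = 3` (the (T2γ) carrier, additive, `≠ 3`), lane B's `Three.CornerInertAdmissibleUpToOne W` exempts
exactly that place (`q₁ :=` the prime under `v₁`): the SHAPE off `q₁` holds (any other prime `q` with `3 ∣ c_q` is split or of type IV ∕ IV* with
`c = 3`, and the latter would be `v₁` again), and with at most ONE split multiplicative `≠ 3` the set `S = {3, q}` (`q` ANY second multiplicative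
prime, split or not) with `R = {3}` is an even inert set `∌ q₁` carrying every split offender. So on (T2γ) the residual binder of `stub_upper3_residualMulti`
(r4b: «multi ∧ ¬Adm ∧ ¬AdmUpToOne») survives only at curves with TWO (T2γ) places, or ONE (T2γ) place and two split primes `≠ 3`, or ONE (T2γ) place and
NO multiplicative prime other than `3` (census N < 5·10⁵, lane B g6: the 3 (DEG) pairs 74778v1 ∕ 240306t1 ∕ 289338bd1 are exactly «`3` non-split,
`S = {3, 2}` or `{3, q}`, the (T2γ) place exempted» — instances of THIS theorem).
* `Three.cornerInertAdmissibleUpToOne_of_uniqueTypeIV_of_atMostOneSplit`.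
Together with p588463 the class-wide complement of «Adm ∨ AdmUpToOne» on the multi-carrier (T4″)₃ corner is:
{≥ 2 (T2γ) places} ∪ {1 (T2γ) place ∧ (≥ 2 split primes ≠ 3 ∨ Mult(E) = {3})} ∪ {0 (T2γ) places ∧ ≥ 3 split primes ≠ 3}.

HONEST FRAMING: THEOREMS ONLY (no definition, no named fact, no `sorry`); bookkeeping over lane B's predicates; nothing about `Ш`; items 21420 ∕ 19111 NOT
closed; BSD is not advanced; T7. Credit: lane B corner3-p2 (predicates), x11b3 (Kodaira–Néron at 3, `addv_of_typeIV`, `primesEquiv_ne_three_of_typeIV`),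
multr1 (place ∕ prime transports).
References (locators only): [cite: SilvermanATAEC1994, IV.9.4 Steps 5, 8 and Cor. IV.9.2(d)] [cite: PastenShimura2024, Lemma 6.18 (shape of the half)]
[cite: Jetchev2008, Cor. 1.5 (the exempted place)].
-/

set_option autoImplicit false
set_option linter.dupNamespace false -- `Summit.BirchSwinnertonDyer.BirchSwinnertonDyer` (summit = problem), tree-wide

noncomputable section

open scoped Classical NumberField

namespace Summit.BirchSwinnertonDyer.Rank1Residual.X11b.Three

open WeierstrassCurve NumberField IsDedekindDomain Field Rat.HeightOneSpectrum
  Literature.NumberTheory.EllipticCurves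
  Literature.NumberTheory.EllipticCurves.Rank1Residual
  Literature.NumberTheory.EllipticCurves.Rank1Residual.Typed
  Summit.BirchSwinnertonDyer.Rank1Residual Summit.BirchSwinnertonDyer.Rank1Residual.X11b
  Summit.BirchSwinnertonDyer.BirchSwinnertonDyer.Theorems

/-- **Admissibility up to one exempted place is AUTOMATIC at a corner curve with a UNIQUE (T2γ) place, at most one split multiplicative prime
`≠ 3`, and a second multiplicative prime.** On a (T4″)₃ corner curve (`ClassX11b W 3`) with a place `v₁` of type IV ∕ IV* which is the ONLY place of
type IV ∕ IV* with `c = 3`, a multiplicative prime `q ≠ 3` (split or not), and no split multiplicative prime other than `3` and `q`: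
`Three.CornerInertAdmissibleUpToOne W` — exempted prime `q₁ :=` the prime under `v₁` (bad, additive, `≠ 3`, `≠ q`), SHAPE off `q₁` from uniqueness
(`split_or_typeIV_of_odd_prime_dvd_localTamagawaNumber` + transports), `S = {3, q}`, `R = {3}` (`3 ∤ 2`). NO congruence condition; `¬ Surj` not used.
[cite: SilvermanATAEC1994, IV.9.4 Steps 5, 8 and Cor. IV.9.2(d)] [cite: PastenShimura2024, Lemma 6.18 (shape)] -/
theorem cornerInertAdmissibleUpToOne_of_uniqueTypeIV_of_atMostOneSplit [Fact (Nat.Prime 3)]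
    (W : WeierstrassCurve ℚ) [W.IsElliptic] [W.IsGloballyMinimal] (hX : ClassX11b W 3)
    {v₁ : HeightOneSpectrum (𝓞 ℚ)} (hk₁ : W.kodairaSymbolAt v₁ = .IV ∨ W.kodairaSymbolAt v₁ = .IVstar)
    (huniq : ∀ v : HeightOneSpectrum (𝓞 ℚ), (W.kodairaSymbolAt v = .IV ∨ W.kodairaSymbolAt v = .IVstar) →
      W.tamagawaNumberAt v = 3 → v = v₁)
    (q : ℕ) [Fact q.Prime] (hq3 : q ≠ 3) (hq : Mult W q)
    (hone : ∀ (q' : ℕ) [Fact q'.Prime], q' ≠ 3 → q' ≠ q → W.HasSplitMultiplicativeReductionAtPrime q' → False) :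
    CornerInertAdmissibleUpToOne W := by
  have hmult3 : Mult W 3 := hX.2.2.1
  -- the exempted prime: the one under the (T2γ) place
  haveI i₁ : Fact (primesEquiv v₁ : ℕ).Prime := ⟨(primesEquiv v₁).2⟩
  have hadd₁ := addv_of_typeIV W hk₁
  have hng₁ : ¬ W.HasGoodReductionAtPrime (primesEquiv v₁ : ℕ) := hadd₁.1
  have hnm₁ : ¬ W.HasMultiplicativeReductionAtPrime (primesEquiv v₁ : ℕ) := hadd₁.2
  have hq₁3 : (primesEquiv v₁ : ℕ) ≠ 3 := primesEquiv_ne_three_of_typeIV W hX hk₁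
  have hq₁q : (primesEquiv v₁ : ℕ) ≠ q := by
    have key : ∀ (r : ℕ) (hr : Fact r.Prime), (primesEquiv v₁ : ℕ) = r →
        ¬ @WeierstrassCurve.HasMultiplicativeReductionAtPrime W r hr := by
      rintro r hr rfl; exact hnm₁
    exact fun h ↦ key q inferInstance h hq
  -- SHAPE off the exempted prime, from uniqueness of the (T2γ) place
  have hshape : ∀ (q' : ℕ) [Fact q'.Prime], q' ≠ (primesEquiv v₁ : ℕ) →
      3 ∣ (W.baseChange ℚ_[q']).localTamagawaNumber ℤ_[q'] → W.HasSplitMultiplicativeReductionAtPrime q' := by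
    intro q' hq' hne h3c
    set v' : HeightOneSpectrum (𝓞 ℚ) := (primesEquiv (R := 𝓞 ℚ)).symm ⟨q', hq'.out⟩ with hv'def
    have hv' : (primesEquiv v' : ℕ) = q' := by rw [hv'def, Equiv.apply_symm_apply]
    have h3' : 3 ∣ W.tamagawaNumberAt v' := by
      rw [tamagawaNumberAt_def, ← WeierstrassCurve.localTamagawaNumber_padic_eq_holds W v' q' hv']
      exact h3c
    rcases split_or_typeIV_of_odd_prime_dvd_localTamagawaNumber W v' Nat.prime_three (by decide) h3'
      with ⟨hs, -⟩ | ⟨-, hk', hc'⟩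
    · have hs' := (W.hasSplitMultiplicativeReductionAtPrime_iff_hasSplitMultiplicativeReductionAt v').mpr hs
      have key : ∀ (r : ℕ) (hr : Fact r.Prime), (primesEquiv v' : ℕ) = r →
          @WeierstrassCurve.HasSplitMultiplicativeReductionAtPrime W r hr := by
        rintro r hr rfl; exact hs'
      exact key q' hq' hv'
    · exact absurd (hv'.symm.trans (congrArg (fun v ↦ (primesEquiv v : ℕ)) (huniq v' hk' hc'))) hne
  refine ⟨(primesEquiv v₁ : ℕ), i₁, hng₁, hshape, {3, q}, ?_, ?_, by simp, ?_, ?_, Or.inr ⟨{3}, by simp, ?_, ?_⟩⟩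
  · intro ℓ hℓ
    rcases Finset.mem_insert.mp hℓ with rfl | hℓq
    · exact ⟨inferInstance, hmult3⟩
    · rw [Finset.mem_singleton] at hℓq
      subst hℓq
      exact ⟨inferInstance, hq⟩
  · rw [Finset.card_pair (Ne.symm hq3)]
    exact ⟨1, rfl⟩
  · intro h
    rcases Finset.mem_insert.mp h with h₁ | h₂
    · exact hq₁3 h₁
    · rw [Finset.mem_singleton] at h₂
      exact hq₁q h₂
  · intro ℓ _ hℓS _ hs
    have hℓ3 : ℓ ≠ 3 := fun h ↦ hℓS (by simp [h])
    have hℓq : ℓ ≠ q := fun h ↦ hℓS (by simp [h])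
    exact (hone ℓ hℓ3 hℓq hs).elim
  · rw [Finset.card_pair (Ne.symm hq3), Finset.card_singleton]
  · intro q' hq'
    rw [Finset.mem_singleton] at hq'
    subst hq'
    decide

end Summit.BirchSwinnertonDyer.Rank1Residual.X11b.Three

end
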